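import Summits.HubbardSuperconductivity.HubbardSuperconductivity.Theorems.AposterioriCapRgAposterioriOrderCriterionRFreeBridge
import Literature.MathematicalPhysics.QuantumLattice.FinDimSpectrumGibbsLimitProofs
import Literature.MathematicalPhysics.QuantumLattice.DWaveOrderParameterProofs

/-!
# Crux `AposterioriOrderCriterionR` (item `stmt-HubbardSuperconductivity-13884`): the criterion at zero coupling
# on the bare-frame sub-report — the whole chain, once, end to end

`--supports stmt-HubbardSuperconductivity-13884` helper of the line lead (seat c3); no definition, no `sorry`,
no named fact.  Every line of the crux composes the same four steps: (i) a tuple reported at `(L, β)` and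
enclosed by the datum floors the realised mean-field density, (ii) the Matsubara bridge `M → ∞` turns it into
the Gibbs anomalous density of the operator model, (iii) `β → ∞` gives the tracial ground-state density
`dWaveSourceDensity`, (iv) the thermodynamic-limit / small-source stair (`le_dWaveOrderParameter_of_forall`)
gives the order parameter.  With the bridge now LANDED at `U = 0` in the bare frame
(`tendsto_scaleMeanFieldDensityCT_free_bridge`), this file runs the chain sorry-free in that case:

* `meanFieldDensity_eq_of_mem_hubbardScaleReport_free` — at `U = 0` a tuple of the bare-frame report
  `hubbardScaleReport 0 μ D h L β` (`L ≥ 3`, `β > 0`) has `m₀ = Re⟨Δ_d⟩_{β, dWaveSourceTorus L 0 μ h}/L²`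
  EXACTLY (Kuratowski upper limit in `M` of values converging by the bridge);
* `fst_le_dWaveSourceDensity_free_of_certified` — an h-certified datum has
  `fst ≤ dWaveSourceDensity L 0 μ h` for all large `L` (zero-temperature limit `tendsto_gibbsState_atTop_holds`);
* `fst_le_dWaveOrderParameter_free_of_certified` — hence `fst ≤ dWaveOrderParameter 0 μ` (stair), and
* `stub_criterion_free_bareReport` — **R's conclusion at `U = 0` for every datum certified on `(0, h₀]` through
  the bare-frame report, with constant `1` and NO thresholds**:
  `fst/2 ≤ dWaveOrderParameter 0 μ` (registered sub-goal of the crux; `hubbardScaleReport ⊆ hubbardScaleReportCT`,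
  `hubbardScaleReport_subset_CT`).

What this does NOT give: R's `U = 0` slice over the CT report (frames `K ≠ 0` need the frame-independence of
the free responses — the Gaussian re-bracketing `N^K · ∫dμ_{C^K} e^{-𝒩_K} = N^0`, not in the tree), and anything
at `U ≠ 0`, where the same chain proves R′ (conclusion at `μ + U/2`), not R (X1).
-/

noncomputable section

namespace Summit.HubbardSuperconductivity.HubbardSuperconductivity.Theorems

open Literature.MathematicalPhysics.QuantumLattice Literature.Probability.LatticeModels
open Filter Finset Matrix
open scoped Topology

set_option linter.dupNamespace false

/-- **At `U = 0` the bare-frame report is honest with constant `1`**: a tuple reported at `(L, β)`, `L ≥ 3`,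
`β > 0`, has mean-field density EQUAL to the Gibbs anomalous density `Re⟨Δ_d⟩_{β, H_L(h)}/L²` of the free
seeded torus (its `m₀` is within every `δ` of realised values `scaleMeanFieldDensity L M β 0 μ h Λ₀` for
infinitely many `M`, and these converge by the free Matsubara bridge). [folklore] -/
theorem meanFieldDensity_eq_of_mem_hubbardScaleReport_free {L : ℕ} [NeZero L] (hL : 3 ≤ L) {β : ℝ} (hβ : 0 < β)
    {μ h : ℝ} {D : HubbardScaleData} {p : HubbardScaleData.Parameters D.numPatches}
    (hp : p ∈ hubbardScaleReport 0 μ D h L β) :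
    p.meanFieldDensity =
      (gibbsState β (dWaveSourceTorus L 0 μ h) (pairField dWaveFormFactor L)).re / (L : ℝ) ^ 2 := by
  set A := (gibbsState β (dWaveSourceTorus L 0 μ h) (pairField dWaveFormFactor L)).re / (L : ℝ) ^ 2 with hA
  rw [hubbardScaleReport_eq, mem_hubbardScaleReportAt_iff] at hp
  have hbridge : Tendsto (fun M : ℕ => scaleMeanFieldDensity L M β 0 μ h (D.scale : ℝ)) atTop (𝓝 A) := by
    have := tendsto_scaleMeanFieldDensityCT_free_bridge hL hβ μ h (D.scale : ℝ)
    simpa only [scaleMeanFieldDensityCT_zero_frame] using this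
  refine eq_of_forall_dist_le fun ε hε => ?_
  have hε2 : 0 < ε / 2 := half_pos hε
  have hev : ∀ᶠ M : ℕ in atTop, |scaleMeanFieldDensity L M β 0 μ h (D.scale : ℝ) - A| < ε / 2 := by
    have := (Metric.tendsto_nhds.1 hbridge) (ε / 2) hε2
    simpa only [Real.dist_eq] using this
  obtain ⟨M, ⟨p', hp', hclose⟩, hM⟩ := ((hp (ε / 2) hε2).and_eventually hev).exists
  obtain ⟨-, q, -, -, -, -, -, -, hm', -⟩ := hp'
  have h1 : |p.meanFieldDensity - p'.meanFieldDensity| < ε / 2 := hclose.2.2.2.2.2.2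
  rw [hm'] at h1
  rw [Real.dist_eq]
  have := abs_sub_le p.meanFieldDensity (scaleMeanFieldDensity L M β 0 μ h (D.scale : ℝ)) A
  linarith

/-- **An h-certified datum floors the free sourced ground-state density** (`U = 0`, bare-frame report): if
`D` is a certified enclosure of `hubbardScaleReport 0 μ D h` from `L₀` on, then
`fst ≤ dWaveSourceDensity L 0 μ h` for every `L ≥ max L₀ 3` (enclosure ⇒ `fst ≤ m₀ = Re⟨Δ_d⟩_β/L²` for all
large `β`, then `β → ∞`: `tendsto_gibbsState_atTop_holds`). [folklore] -/
theorem fst_le_dWaveSourceDensity_free_of_certified {μ h : ℝ} {D : HubbardScaleData} {L₀ : ℕ}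
    (hcert : D.IsCertifiedEnclosure (hubbardScaleReport 0 μ D h) L₀) {L : ℕ} [NeZero L] (hL₀ : L₀ ≤ L) (hL : 3 ≤ L) :
    ((D.meanFieldDensity.fst : ℚ) : ℝ) ≤ dWaveSourceDensity L 0 μ h := by
  obtain ⟨β₀, hβ₀⟩ := hcert L hL₀
  -- for `β ≥ max β₀ 1`: `fst ≤ Re⟨Δ_d⟩_β / L²`
  have key : ∀ β : ℝ, max β₀ 1 ≤ β →
      ((D.meanFieldDensity.fst : ℚ) : ℝ) ≤
        (gibbsState β (dWaveSourceTorus L 0 μ h) (pairField dWaveFormFactor L)).re / (L : ℝ) ^ 2 := by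
    intro β hβ
    obtain ⟨p, hp, henc⟩ := hβ₀ β (le_of_max_le_left hβ)
    have hβpos : 0 < β := lt_of_lt_of_le one_pos (le_of_max_le_right hβ)
    rw [← meanFieldDensity_eq_of_mem_hubbardScaleReport_free hL hβpos hp]
    exact henc.fst_le_meanFieldDensity
  -- `β → ∞`
  have hH : (dWaveSourceTorus L 0 μ h).IsHermitian :=
    dWaveSourceTorus_isHermitian L (isHermitian_hubbardTorusWith L 1 0 μ) h
  have hlim : Tendsto (fun β : ℝ =>
      (gibbsState β (dWaveSourceTorus L 0 μ h) (pairField dWaveFormFactor L)).re / (L : ℝ) ^ 2) atTop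
      (𝓝 (dWaveSourceDensity L 0 μ h)) := by
    have h1 := Matrix.tendsto_gibbsState_atTop_holds hH (pairField dWaveFormFactor L)
    have h2 := ((Complex.continuous_re.tendsto _).comp h1).div_const ((L : ℝ) ^ 2)
    simpa only [dWaveSourceDensity, Function.comp_def] using h2
  exact ge_of_tendsto hlim (eventually_atTop.2 ⟨max β₀ 1, key⟩)

/-- **Hence a floor on the order parameter** (`U = 0`, bare-frame report): a datum certified for every
`h ∈ (0, h₀]` has `fst ≤ dWaveOrderParameter 0 μ` (the stair `le_dWaveOrderParameter_of_forall` over the inner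
`liminf_L`, which the eventual floor bounds from below; the density is a priori bounded above). [folklore] -/
theorem fst_le_dWaveOrderParameter_free_of_certified {μ h₀ : ℝ} {D : HubbardScaleData} (hh₀ : 0 < h₀)
    (hcert : ∀ h ∈ Set.Ioc (0 : ℝ) h₀, ∃ L₀ : ℕ, D.IsCertifiedEnclosure (hubbardScaleReport 0 μ D h) L₀) :
    ((D.meanFieldDensity.fst : ℚ) : ℝ) ≤ dWaveOrderParameter 0 μ := by
  refine le_dWaveOrderParameter_of_forall 0 μ hh₀ fun h hh => ?_
  obtain ⟨L₀, hc⟩ := hcert h ⟨hh.1, hh.2.le⟩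
  have hev : ∀ᶠ L : ℕ in atTop, ((D.meanFieldDensity.fst : ℚ) : ℝ) ≤ dWaveSourceDensity (L + 1) 0 μ h := by
    filter_upwards [eventually_ge_atTop (max L₀ 3)] with L hL
    exact fst_le_dWaveSourceDensity_free_of_certified hc
      ((le_max_left _ _).trans (hL.trans (Nat.le_succ L))) ((le_max_right _ _).trans (hL.trans (Nat.le_succ L)))
  exact le_liminf_of_le (isCoboundedUnder_ge_of_le _ fun L => dWaveSourceDensity_le_const _ 0 μ h) hev

/-- **The criterion at zero coupling on the bare-frame sub-report** (registered sub-goal of the crux): for EVERY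
`μ`, `h₀ > 0` and every scale datum `D` that is an h-certified enclosure of the bare-frame report of the FREE
seeded torus on `(0, h₀]`, R's conclusion `fst/2 ≤ dWaveOrderParameter 0 μ` holds — with no thresholds at all
(indeed `fst ≤ dWaveOrderParameter 0 μ`, and the order parameter is never negative).  This is the chain
report → Matsubara bridge → zero-temperature limit → stair, kernel-checked end to end in the one case where the
bridge is in the tree; `hubbardScaleReport ⊆ hubbardScaleReportCT` (`hubbardScaleReport_subset_CT`). [folklore] -/
theorem stub_criterion_free_bareReport :
    ∀ (μ h₀ : ℝ) (D : HubbardScaleData), 0 < h₀ →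
      (∀ h ∈ Set.Ioc (0 : ℝ) h₀, ∃ L₀ : ℕ, D.IsCertifiedEnclosure (hubbardScaleReport 0 μ D h) L₀) →
      ((D.meanFieldDensity.fst : ℚ) : ℝ) / 2 ≤ dWaveOrderParameter 0 μ := by
  intro μ h₀ D hh₀ hcert
  have h1 := fst_le_dWaveOrderParameter_free_of_certified hh₀ hcert
  have h2 := dWaveOrderParameter_nonneg 0 μ
  linarith

end Summit.HubbardSuperconductivity.HubbardSuperconductivity.Theorems
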